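import Summits.Ventures.DiscreteObjects.Hadamard.ConferenceGraph333

/-!
# srg(333,166,82,83) has no equitable partition into three cells of size 111 (kernel)

Framing: lottery ticket; floor = certified bounds/negative ranges.  Cell pub-namedobj (venture DiscreteObjects),
target (H) = a Hadamard matrix of order `668`, hadamard gen 28; companion of `GroupCore334` (no group-developed core
of `C(334)`) on the symmetric side of the order-334 line: `srg(333,166,82,83)` ⇔ symmetric `C(334)` ⇒ `H(668)`
(gen 27 `ConferenceGraph333`, `Order334Routes668`).  After 'regular group on the core' the next structured
sub-family is an automorphism group with FEW LARGE ORBITS; the orbit-matrix method for (Seidel matrices of)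
strongly regular graphs is Behbahani–Lam 2011 / Crnković–Egan–Švob 2020 (AMC, doi:10.3934/amc.2020032, Thm 2.3).
Gen 27 showed that for `ℤ/37` acting semiregularly on the core (nine orbits of size `37`) orbit matrices EXIST.
THIS FILE settles the coarsest case completely, with no search:

* **`no_threeCells_seidel333`** — let `S` be a symmetric `333 × 333` Seidel matrix (`0` diagonal, `±1` off it, zero
  row sums, `S² = 333·I − J`: the core of a normalised symmetric `C(334)`), and let the index set be partitioned into
  cells of size `111` EQUITABLY for `S` (cell sums `Σ_{y ∈ cell j} S_{xy} = R(cls x, j)` depend only on the cell of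
  `x`; e.g. the orbits of any automorphism group with three orbits of size `111`).  Then: there are exactly three
  cells; the class-sum matrix `R` is symmetric (double counting), has zero row sums, EVEN diagonal (`110` odd terms)
  and `Σ_j R_{ij}² = 222` (the orbit-matrix identity `Σ_j R_{ij}R_{jk} = 333[i=k] − 111` at `i = k`); an even `a` with
  `a + b + c = 0`, `a² + b² + c² = 222` has `a² = 100` (**`even_entry_sq_eq_100`**: the rows are signed permutations
  of `(10, 1, −11)`), so the three off-diagonal squares `x = R₁₂², y = R₁₃², z = R₂₃²` satisfy
  `x + y = x + z = y + z = 122`, i.e. `x = 61` — not a square (**`int_sq_ne_61`**).  Contradiction.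
* **`no_threeCells_srg333`** — the same for the adjacency matrix of an `srg(333,166,82,83)` (hypotheses of
  `ConferenceGraph333`; `B(cls x, j)` = number of neighbours in cell `j`), via `seidel_identities_of_conferenceGraph`.
* **`no_threeOrbits111_srg333`** — no group `Γ` of automorphisms of an `srg(333,166,82,83)` has three orbits of
  size `111` (stated with an invariant orbit labelling and transitivity on cells): in particular NO automorphism
  group of order `111` (`ℤ/111` or `ℤ/37 ⋊ ℤ/3`) acts semiregularly, and no group of order `333` acts regularly
  (an index-3 subgroup would have three orbits of size `111`) — the symmetric case of `GroupCore334`, which there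
  needs no symmetry (parity).  NOTE: for a NON-symmetric `C(334)` with a semiregular group of order `111` on the
  core the `3 × 3` orbit-matrix system HAS solutions (`circ(−10,−1,11)` and its images; hub-local enumeration), so
  this file says nothing about that case.
Census words: 'srg(333,166,82,83) / symmetric C(334) with an automorphism group having three orbits of size 111 on
the core points: EMPTY (kernel, orbit-matrix level decides)'.  The instance is ours (PROVISIONAL); the method is the
printed orbit-matrix method.  `srg(333,166,82,83)`, `C(334)`, `H(668)` themselves untouched.  No `sorry`, no new
definitions; imports gen 27's `ConferenceGraph333` only.
-/

namespace Summit.Ventures.DiscreteObjects.Hadamard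

open Finset

/-! ## §1 Arithmetic -/

/-- The rows of the `3 × 3` class-sum matrix: `a + b + c = 0`, `a² + b² + c² = 222`, `a` even force `a² = 100`
(the solutions are the signed permutations of `(10, 1, −11)`). -/
theorem even_entry_sq_eq_100 (a b c : ℤ) (h0 : a + b + c = 0) (h2 : a * a + b * b + c * c = 222) (ha : 2 ∣ a) :
    a * a = 100 := by
  obtain ⟨a', rfl⟩ := ha
  have hc : c = -(2 * a') - b := by linarith
  subst hc
  have h1 : -8 < a' ∧ a' < 8 := by constructor <;> nlinarith
  have h3 : -15 < b ∧ b < 15 := by constructor <;> nlinarith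
  obtain ⟨h1a, h1b⟩ := h1
  obtain ⟨h3a, h3b⟩ := h3
  interval_cases a' <;> interval_cases b <;> omega

/-- `61` is not a square. -/
theorem int_sq_ne_61 (r : ℤ) : r * r ≠ 61 := by
  intro h
  have h1 : -8 < r ∧ r < 8 := by constructor <;> nlinarith
  obtain ⟨h1a, h1b⟩ := h1
  interval_cases r <;> omega

/-! ## §2 Seidel matrices of order `333` with an equitable three-partition -/

section seidel
variable {V ι : Type*} [Fintype V] [DecidableEq V] [Fintype ι] [DecidableEq ι]

/-- **No equitable partition of a conference two-graph core of order `333` into cells of size `111`.**  Let `S` be a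
symmetric `333 × 333` matrix with zero diagonal, `±1` off it, zero row sums and `S² = 333·I − J` (the core of a
normalised symmetric `C(334)` = the Seidel matrix of an `srg(333,166,82,83)`), and let `cls : V → ι` be a partition
into cells of size `111` which is EQUITABLE for `S` (the cell sums `Σ_{y ∈ cell j} S_{x,y} = R(cls x, j)` depend only
on the cell of `x`).  Then `False`: the class-sum matrix `R` is symmetric with `R_{ii}` even, zero row sums and
`Σ_j R_{ij}² = 222`, whence `R_{ii}² = 100` and the three off-diagonal squares `x, y, z` satisfy
`x + y = x + z = y + z = 122`, i.e. `x = 61`, not a square. -/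
theorem no_threeCells_seidel333 (hV : Fintype.card V = 333) (S : Matrix V V ℤ) (hSd : ∀ x, S x x = 0)
    (hSo : ∀ x y, x ≠ y → S x y = 1 ∨ S x y = -1) (hSs : ∀ x y, S y x = S x y) (hS1 : ∀ x, ∑ y, S x y = 0)
    (hSS : ∀ x y, ∑ z, S x z * S z y = 333 * (if x = y then 1 else 0) - 1)
    (cls : V → ι) (hsize : ∀ i, (univ.filter fun y => cls y = i).card = 111)
    (R : ι → ι → ℤ) (hR : ∀ x j, ∑ y ∈ univ.filter (fun y => cls y = j), S x y = R (cls x) j) : False := by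
  -- representatives
  have hrep : ∀ i, ∃ x, cls x = i := fun i => by
    obtain ⟨x, hx⟩ := Finset.card_pos.mp (by rw [hsize i]; norm_num : 0 < (univ.filter fun y => cls y = i).card)
    exact ⟨x, (Finset.mem_filter.mp hx).2⟩
  choose rep hrep using hrep
  -- (a) zero row sums of R
  have hRsum : ∀ i, ∑ j, R i j = 0 := by
    intro i
    rw [← hS1 (rep i), ← Finset.sum_fiberwise univ cls fun y => S (rep i) y]
    exact Finset.sum_congr rfl fun j _ => by rw [hR, hrep]
  -- (b) Σ_j R i j * R j i = 222
  have hRR : ∀ i, ∑ j, R i j * R j i = 222 := by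
    intro i
    have h1 : ∀ j, R i j * R j i = ∑ z ∈ univ.filter (fun y => cls y = j), S (rep i) z * R (cls z) i := by
      intro j
      rw [show R i j = ∑ z ∈ univ.filter (fun y => cls y = j), S (rep i) z by rw [hR (rep i) j, hrep i],
        Finset.sum_mul]
      refine Finset.sum_congr rfl fun z hz => ?_
      rw [(Finset.mem_filter.mp hz).2]
    rw [Finset.sum_congr rfl fun j _ => h1 j, Finset.sum_fiberwise univ cls fun z => S (rep i) z * R (cls z) i]
    have h2 : ∀ z, S (rep i) z * R (cls z) i = ∑ y ∈ univ.filter (fun y => cls y = i), S (rep i) z * S z y := by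
      intro z; rw [← hR z i, Finset.mul_sum]
    rw [Finset.sum_congr rfl fun z _ => h2 z, Finset.sum_comm]
    have h3 : ∀ y, ∑ z, S (rep i) z * S z y = 333 * (if rep i = y then 1 else 0) - 1 := fun y => hSS _ _
    rw [Finset.sum_congr rfl fun y _ => h3 y, Finset.sum_sub_distrib, ← Finset.mul_sum, Finset.sum_ite_eq,
      Finset.sum_const, hsize]
    simp [hrep i]
  -- (c) symmetry of R
  have hRsym : ∀ i j, R j i = R i j := by
    intro i j
    have hi : ∑ x ∈ univ.filter (fun y => cls y = i), ∑ y ∈ univ.filter (fun y => cls y = j), S x y =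
        111 * R i j := by
      rw [Finset.sum_congr rfl fun x hx => by rw [hR x j, (Finset.mem_filter.mp hx).2], Finset.sum_const, hsize]
      simp
    have hj : ∑ y ∈ univ.filter (fun y => cls y = j), ∑ x ∈ univ.filter (fun y => cls y = i), S y x =
        111 * R j i := by
      rw [Finset.sum_congr rfl fun y hy => by rw [hR y i, (Finset.mem_filter.mp hy).2], Finset.sum_const, hsize]
      simp
    have : ∑ x ∈ univ.filter (fun y => cls y = i), ∑ y ∈ univ.filter (fun y => cls y = j), S x y =
        ∑ y ∈ univ.filter (fun y => cls y = j), ∑ x ∈ univ.filter (fun y => cls y = i), S y x := by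
      rw [Finset.sum_comm]
      exact Finset.sum_congr rfl fun y _ => Finset.sum_congr rfl fun x _ => (hSs x y).symm
    have h := hi.symm.trans (this.trans hj)
    linarith
  -- (d) R i i is even: 110 odd terms
  have hReven : ∀ i, 2 ∣ R i i := by
    intro i
    rw [show R i i = ∑ y ∈ univ.filter (fun y => cls y = i), S (rep i) y by rw [hR (rep i) i, hrep i]]
    have hmem : rep i ∈ univ.filter (fun y => cls y = i) := Finset.mem_filter.mpr ⟨Finset.mem_univ _, hrep i⟩
    rw [← Finset.add_sum_erase _ _ hmem, hSd, zero_add]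
    have hcast : (((∑ y ∈ (univ.filter (fun y => cls y = i)).erase (rep i), S (rep i) y : ℤ) : ZMod 2)) = 0 := by
      rw [Int.cast_sum]
      have : ∀ y ∈ (univ.filter (fun y => cls y = i)).erase (rep i), ((S (rep i) y : ℤ) : ZMod 2) = 1 := by
        intro y hy
        rcases hSo (rep i) y (Finset.ne_of_mem_erase hy).symm with h | h <;> rw [h] <;> decide
      rw [Finset.sum_congr rfl this, Finset.sum_const, Finset.card_erase_of_mem hmem, hsize, nsmul_eq_mul, mul_one]
      decide
    exact (ZMod.intCast_zmod_eq_zero_iff_dvd _ 2).mp hcast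
  -- (e) three cells
  have hcard : Fintype.card ι = 3 := by
    have h := Finset.card_eq_sum_card_fiberwise (s := (univ : Finset V)) (t := (univ : Finset ι)) (f := cls)
      fun _ _ => Finset.mem_univ _
    simp only [hsize, Finset.sum_const, smul_eq_mul, Finset.card_univ, hV] at h
    omega
  obtain ⟨i₁, i₂, i₃, h12, h13, h23, huniv⟩ :=
    Finset.card_eq_three.mp (show (univ : Finset ι).card = 3 by rw [Finset.card_univ, hcard])
  have hsum3 : ∀ f : ι → ℤ, ∑ j, f j = f i₁ + f i₂ + f i₃ := by
    intro f
    rw [huniv, Finset.sum_insert (by simp [h12, h13]), Finset.sum_pair h23]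
    ring
  -- (f) rows
  have hrow : ∀ i, R i i * R i i = 100 ∧ R i i₁ * R i i₁ + R i i₂ * R i i₂ + R i i₃ * R i i₃ = 222 := by
    intro i
    have h0 := hRsum i
    have h2 := hRR i
    rw [hsum3] at h0 h2
    rw [hRsym i i₁, hRsym i i₂, hRsym i i₃] at h2
    refine ⟨?_, h2⟩
    -- locate i among i₁ i₂ i₃
    have hi : i = i₁ ∨ i = i₂ ∨ i = i₃ := by
      have : i ∈ ({i₁, i₂, i₃} : Finset ι) := huniv ▸ Finset.mem_univ i
      simpa using this
    rcases hi with rfl | rfl | rfl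
    · exact even_entry_sq_eq_100 _ _ _ h0 h2 (hReven _)
    · exact even_entry_sq_eq_100 (R i i) (R i i₁) (R i i₃) (by linarith) (by linarith) (hReven _)
    · exact even_entry_sq_eq_100 (R i i) (R i i₁) (R i i₂) (by linarith) (by linarith) (hReven _)
  obtain ⟨h1d, h1r⟩ := hrow i₁
  obtain ⟨h2d, h2r⟩ := hrow i₂
  obtain ⟨h3d, h3r⟩ := hrow i₃
  rw [hRsym i₁ i₂] at h2r
  rw [hRsym i₁ i₃, hRsym i₂ i₃] at h3r
  exact int_sq_ne_61 (R i₁ i₂) (by linarith)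

end seidel

/-! ## §3 The strongly regular graph and its automorphism groups -/

section srg
variable {V ι : Type*} [Fintype V] [DecidableEq V] [Fintype ι] [DecidableEq ι]

/-- **`srg(333,166,82,83)` has no equitable partition into cells of size `111`** (adjacency-matrix hypotheses as in
`ConferenceGraph333`; `B(cls x, j)` = number of neighbours of `x` in cell `j`). -/
theorem no_threeCells_srg333 (hV : Fintype.card V = 333) (A : Matrix V V ℤ) (h01 : ∀ x y, A x y = 0 ∨ A x y = 1)
    (hsymm : ∀ x y, A y x = A x y) (hdiag : ∀ x, A x x = 0) (hk : ∀ x, ∑ y, A x y = 166)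
    (hsrg : ∀ x y, ∑ z, A x z * A z y = 83 * (1 + (if x = y then 1 else 0)) - A x y)
    (cls : V → ι) (hsize : ∀ i, (univ.filter fun y => cls y = i).card = 111)
    (B : ι → ι → ℤ) (hB : ∀ x j, ∑ y ∈ univ.filter (fun y => cls y = j), A x y = B (cls x) j) : False := by
  obtain ⟨hSd, hSo, hSs, hS1, hSS⟩ := seidel_identities_of_conferenceGraph A h01 hsymm hdiag 83
    (by rw [hV]; norm_num) (fun x => by rw [hk x]; norm_num) hsrg
  refine no_threeCells_seidel333 hV (fun x y => 1 - (if x = y then 1 else 0) - 2 * A x y) hSd hSo hSs hS1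
    (fun x y => by rw [hSS x y, hV]; norm_num) cls hsize
    (fun i j => 111 - (if i = j then 1 else 0) - 2 * B i j) fun x j => ?_
  rw [Finset.sum_sub_distrib, Finset.sum_sub_distrib, Finset.sum_const, hsize, ← Finset.mul_sum, hB x j,
    Finset.sum_ite_eq]
  simp [Finset.mem_filter]

/-- **No group of automorphisms of `srg(333,166,82,83)` has three orbits of size `111`** — e.g. no automorphism
group of order `111` (cyclic or `ℤ/37 ⋊ ℤ/3`) acting semiregularly, and no group of order `333` acting regularly
(its index-3 subgroups would act with three orbits of size `111`): orbit partitions of automorphism groups are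
equitable.  Stated for an action of `Γ` on `V` preserving `A`, an invariant labelling `cls` of the orbits, and
transitivity of `Γ` on each cell. -/
theorem no_threeOrbits111_srg333 {Γ : Type*} [Group Γ] [MulAction Γ V] (hV : Fintype.card V = 333)
    (A : Matrix V V ℤ) (h01 : ∀ x y, A x y = 0 ∨ A x y = 1) (hsymm : ∀ x y, A y x = A x y)
    (hdiag : ∀ x, A x x = 0) (hk : ∀ x, ∑ y, A x y = 166)
    (hsrg : ∀ x y, ∑ z, A x z * A z y = 83 * (1 + (if x = y then 1 else 0)) - A x y)
    (hA : ∀ (γ : Γ) x y, A (γ • x) (γ • y) = A x y) (cls : V → ι) (hcls : ∀ (γ : Γ) x, cls (γ • x) = cls x)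
    (htrans : ∀ x x', cls x = cls x' → ∃ γ : Γ, γ • x = x')
    (hsize : ∀ i, (univ.filter fun y => cls y = i).card = 111) : False := by
  have hrep : ∀ i, ∃ x, cls x = i := fun i => by
    obtain ⟨x, hx⟩ := Finset.card_pos.mp (by rw [hsize i]; norm_num : 0 < (univ.filter fun y => cls y = i).card)
    exact ⟨x, (Finset.mem_filter.mp hx).2⟩
  choose rep hrep using hrep
  refine no_threeCells_srg333 hV A h01 hsymm hdiag hk hsrg cls hsize
    (fun i j => ∑ y ∈ univ.filter (fun y => cls y = j), A (rep i) y) fun x j => ?_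
  obtain ⟨γ, hγ⟩ := htrans (rep (cls x)) x (hrep (cls x))
  have hx : rep (cls x) = γ⁻¹ • x := eq_inv_smul_iff.mpr hγ
  -- Σ_{y ∈ cell j} A x y = Σ_{y ∈ cell j} A (γ⁻¹ • x) (γ⁻¹ • y), reindexing the cell by `γ⁻¹`
  rw [Finset.sum_filter, Finset.sum_filter]
  refine Fintype.sum_equiv (MulAction.toPerm γ⁻¹) _ _ fun y => ?_
  rw [MulAction.toPerm_apply, hcls, hx, hA]

end srg

end Summit.Ventures.DiscreteObjects.Hadamard
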